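import Summits.QuantumFields.BalabanUV.T4Continuum.Support.NE9CurChartTowerUniformBall
import Literature.MathematicalPhysics.QuantumFieldTheory.Balaban1983to89.B9Eq3126EnergyBallTowerPiCLM
import Literature.MathematicalPhysics.QuantumFieldTheory.Balaban1983to89.B9Thm311LaplaceAkPiPositiveDiagonal
import Literature.MathematicalPhysics.QuantumFieldTheory.Balaban1983to89.B7Eq43AveragedSmallnessLinearFeed

/-!
# NE9CurChartTowerPiUniformBall — THE CHART OF THE CURVE SPECIES `cur U` FOR PRINT's `k`-TH-STEP OPERATOR (3.122)
# `Δ̃_{a,k}(U) = π_k†Δ^ηπ_k + D_UR_kD*_U + Q_k*aQ_k` (`B9Eq3119DeltaPiTower.laplaceAkPi`, print's `G̃⁻¹`) EXISTS ON ONE AND THE SAME BALL FOR EVERY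
# UNITARY BACKGROUND OF PRINT's SMALL-FIELD CLASS (3.35) ON A FIXED LATTICE — `Support/NE9CurChartTowerUniformBall` (row OWNER t4-ne9-p1, gen 83; the
# chain's operator `laplaceAk` = print's `G₀⁻¹` of p. 421) RE-INSTANTIATED AT PRINT's OPERATOR, the radii `ε₄ ε_C R_b R′` and the window threshold `α₁`
# chosen BEFORE `∀ U`; cell `pub-balaban`, T4-DAG §2 node U3 ∕ §6 NE9, route R2′ (instance-ledger row L12 «the Δ_π port G₀ ↦ G̃»); NE9 crux-team (2) leaf
# prover 03 (`b2b-balaban-t4-ne9-formalise-leaf-03`, gen 68); Summits-side NEW leaf under the row OWNER's INTERFACE REQUEST NE9 [NE9P1-G88-IFR]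
# (HOME/INBOX.md 2026-08-23T13:02Z; ruling e34b3e0c (0) «no new leaves unless a CRUX prover requests a specific NAMED interface»; acknowledged as
# admissible by the acting cell lead, WORD A-lead-g86-4; typist of record by the OWNER's call W-9 (β)); nothing printed asserted

HONEST FRAMING (T4-DAG PAGE 1).  Rung (B)+1 of the FINITE-VOLUME T⁴ programme — NOT infinite volume, NOT a mass gap, NOT the Clay problem.  NE9 is a
cell NEW ESTIMATE, NOT PRINTED in [Balaban1987RG1] ∕ [Balaban1988RG2Cluster], and NOT PROVED here («NE9 ⇐ the named binders»; spine PROVED 0∕9).  HONEST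
DEPENDENCY (cell line, verbatim): continuum YM on T⁴ ⇐ BetaPertH ∧ nine spine estimates (0/9 proved); BetaPertH ⇐ (D1) ∧ (D4) ∧ CAP+tail; G-an2-4
gates asym, D1 and NE2/3/4.  The `cur U` OBJECT is ONE item of the MODEL O-NE9-1 (species (a) data); `act` ∕ `ker` and NEEDS-COORDINATOR #5 untouched.

WHY THIS FILE.  The row OWNER's DIAGNOSIS D-ne9p1-g87-1: every `…Tower…` chart file of the chain is stated for `B9Eq326OperatorTower.laplaceAk` — the BARE
Hessian (3.10) in the `Δ₁`-slot, print's `G₀`; print's `H` (3.126) and `𝔊` (3.153) ([Balaban1985Variational] (45), (110)–(111)), the letters with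
`Q𝔊 = 0`, `RD*𝔊 = 0` (p. 294), are those of the OTHER operator `G̃⁻¹ = Δ_π + DRD* + Q*aQ` (3.122).  The Δ_π port (gens 87–88 of the OWNER, gens 66–67 of
this lineage and ne9-leaf-02) put every supplier AT PRINT's OPERATOR in the tree: the positivity of `Δ̃_{a,k}(U)` on the diagonal
(`B9Thm311LaplaceAkPiPositiveDiagonal.exists_laplaceAkPi_pos_diagonal_closed`), the operator-norm bounds of `H̃_{1,k}(U)`, `𝔊̃_k(U)` in the chart's Banach
type with (117)'s U-FREE finite-lattice factor displayed (`B9Eq3126EnergyBallTowerPiCLM.exists_energy_ball_pi_CLM_diagonal_closed`), the positivity of the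
site operator `Δ′_{a′,k}(U)` that defines `G′_k` inside (3.122) (`B9Thm311SitePrimeFormCoerciveTowerCanonical.exists_strong_site_coercive_tower_diagonal`),
and the α-linear feed that turns print's two windows into E162-type level letters (`B7Eq43AveragedSmallnessLinearFeed.twoWindows_linear_feed`).  This file
composes them with the host's OPERATOR-GENERIC plumbing (`B11Eq118RegimeScalars.exists_twoRegimes_radii_of_bounds`, `B11Eq44CLetterTower.quadAnalytic_Cck`
∕ `analyticOnNhd_Cck`, `NE9B11ChartAnalytic.chartHB_triple_of_twoRegimes`) — the k-level `cur U` chart AT PRINT's OPERATOR, on one ball, on print's class.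

WHAT THIS FILE PROVES (ONE theorem; 0 def, 0 sorry, axioms standard).  **`cur_chart_exists_tower_pi_of_small_field_unitary_uniform`** — the host's
§1∕§2 HYBRID at `laplaceAkPi`: for a fixed tower lattice `towerP L m (n+1)` on print's diagonal (`ηL^{n+1} = 1`, `3 ≤ L^{n+1}`, weights
`c₀(L^{n+1})^d = c₁`), fixed level maps, an averaging-closed gauge class `G ≤ U1` with `C_k`'s numerics `(α₀, ρ)`, print's parameters `a, a′ > 0`
and the (L3) constants `(C₄, a₃)`: `∃ α₁ ε₄ ε_C R_b R′` (`α₁, R_b, R′ > 0`; finite-lattice numbers) BEFORE `∀ U`, such that for EVERY background `U`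
with `Ũ ∈ G`, `0 ≤ α ≤ α₁`, unitary `U(b)* = U(b)⁻¹`, in print's two windows `‖U(b) − 1‖ ≤ αη`, `‖U(∂p) − 1‖ ≤ αη²` (3.35), and every admissible
(L3) slot `Wq`: `∃ h52` ([Balaban1985Averaging] (52), PRODUCED from the plaquette window), `∃ hpos′` (site operator positive), `∃ hpos` (print's
`Δ̃_{a,k}(U)` positive, E162's per-level data PRODUCED by `ulev_mem_U1_of_pdev` ∕ `ulev_reg_of_pdev` at the profile `αT d L α₀`) and the triple (Ψ1)
`DifferentiableOn ℂ` on `ball 0 R_b`, (Ψ2) `MapsTo (ball 0 R_b) (ball 0 R′)`, (Ψ3) value `0` at `0` for the chart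
`chartHB 𝔊̃ 0 Wq 0 (A′ ↦ A′ + solA H̃₁ 0 C_k 0 ε_C A′) ε₄ H̃₁` with `𝔊̃ := frakGLatticeCLM φ hpos (QkW_surjective …)`, `H̃₁ := H1LatticeCLM φ hpos
(QkW_surjective …)` — the host §2's triple with `hpos` the `laplaceAkPi`-witness.  PROOF: the three π-suppliers `∃`-first at `r = 1∕L`,
`ρ_w := |η|^d∕c₀`; the feed below the least threshold; the bounds `C·V_H`, `C·V_G` are U-free, so the regimes' scalars precede `∀ U`;
`α₁ := min T (α₀∕2)`; `U(b) ∈ G` from `Ũ ∈ G` (`perSite_liftSite`); (52) by `pdev_perCfg_le_of_plaq` and `α < α₀`; `hRS` by `hRS_of_unitary`;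
`hpos′` from the strong site coercivity; `hpos`, the CLM bounds at the produced data; `C_k`'s numerics and the composition verbatim as the host.
DISGUISE TEST: composition by name of landed theorems; no inequality of the series proved; the radii are finite-lattice numbers ((117)'s
volume ∕ `2|η|⁻¹` factor inside the bounds) — NOT print's uniformity in the LATTICE ([Balaban1985BackgroundPropagators] Thms 3.12∕3.13), NOT the
(L3) `W`, NOT the gauge step of p. 416, NOT claimed that Bałaban's 𝐇_k meets these letters (O-NE9-1; #5 UNRULED); not NE9.
References (TYPES ∕ loci only): [Balaban1985Variational] (44)–(47) p. 285, Prop. 6 (117)–(121) p. 295, (172)–(175) p. 305;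
[Balaban1985BackgroundPropagators] (3.15)∕(3.19) p. 393, (3.24)–(3.26) pp. 394–395, (3.35)–(3.37) p. 396, Thm 3.11 p. 416, (3.119)–(3.126)
pp. 419–420, (3.130) p. 421, (3.153) p. 426, Thm 3.13 p. 426; [Balaban1985Averaging] (42)–(43) pp. 23–24, Prop. 2 (52)–(54) p. 26.
-/

noncomputable section

open Metric Set

namespace Summit.QuantumFields.BalabanUV.T4Continuum.NE9CurChartTowerPiUniformBall

open scoped InnerProductSpace ComplexConjugate
open Literature.MathematicalPhysics.QuantumFieldTheory.Balaban1983to89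
open B11Eq103H1Complex B11Eq115Space B11Eq174Chart
open B11Eq111FrakG (nabla115)
open B13Contraction113 (QuadAnalytic)
open B9SectCLatticeCarrier (Bond)
open B4Sect5Torus (TSite)
open B7Prop1Explicit (U1 Wcx boxVec)
open B7Prop2Explicit (pdev AvgClosed C0 c2')
open B7Prop3Flat (c3)
open B9Eq315QTorus (perCfg cornerSite)
open B9Eq315QTower (towerP UlevOf)
open B9Eq326OperatorTower (QkW QkW_surjective)
open B9Eq310HessianOperator (adTransportW)
open B9Eq310DeltaPrime (plaqHolU)
open B9Eq324DeltaPrimeATower (laplacePrimeAk)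
open B9Eq3119DeltaPiTower (laplaceAkPi)
open B11Eq118RegimeScalars (exists_twoRegimes_radii_of_bounds)
open B11Eq44COperatorTower (C2T C2T_nonneg αT αT_le ulev_mem_U1_of_pdev ulev_reg_of_pdev)
open B11Eq44CLetterTower (Cck quadAnalytic_Cck analyticOnNhd_Cck)
open B9Thm311SmallFieldClosed (hRS_of_unitary)
open B9Eq315QTorusOnto (liftSite perSite_liftSite)
open B7Eq43AveragedSmallnessLevelFree (pdev_perCfg_le_of_plaq)
open B7Eq43AveragedSmallnessLinearFeed (twoWindows_linear_feed)
open B9Thm311SitePrimeFormCoerciveTowerCanonical (exists_strong_site_coercive_tower_diagonal)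
open B9Thm311LaplaceAkPiPositiveDiagonal (exists_laplaceAkPi_pos_diagonal_closed)
open B9Eq3126EnergyBallTowerPiCLM (exists_energy_ball_pi_CLM_diagonal_closed)
open Summit.QuantumFields.BalabanUV.T4Continuum.NE9B11ChartAnalytic (chartHB_triple_of_twoRegimes)

-- deep definitional unfolding `laplaceAkPi` ↦ `laplaceALatticeK … (π†Δπ) …` in the statement (as the π-suppliers)
set_option maxRecDepth 8192 in
/-- **THE CHART OF `cur U` FOR PRINT's `k`-TH-STEP OPERATOR `Δ̃_{a,k}(U)` (3.122) EXISTS ON ONE AND THE SAME BALL FOR EVERY UNITARY BACKGROUND OF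
PRINT's SMALL-FIELD CLASS (3.35) OF A FIXED LATTICE** (`Ũ ∈ G` averaging-closed with `C_k`'s numerics, the two windows `‖U(b) − 1‖ ≤ αη`,
`‖U(∂p) − 1‖ ≤ αη²`, `0 ≤ α ≤ α₁`, unitarity; (52), the site positivity `hpos′`, the positivity `hpos` of `laplaceAkPi` and E162's per-level data
PRODUCED): `∃ α₁ ε₄ ε_C R_b R′` BEFORE `∀ U`; `hpos′` by `exists_strong_site_coercive_tower_diagonal`, `hpos` by `exists_laplaceAkPi_pos_diagonal_closed`,
the letters' U-free operator-norm bounds by `exists_energy_ball_pi_CLM_diagonal_closed`, all fed by `twoWindows_linear_feed` at `r = 1∕L`; `C_k`'s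
constants by `quadAnalytic_Cck`, the regimes' scalars by `exists_twoRegimes_radii_of_bounds`, composition by `chartHB_triple_of_twoRegimes`. [folklore]
[cite: Balaban1985BackgroundPropagators, (3.122) p.420, (3.126) p.420, (3.153) p.426, Thm 3.11 p.416, (3.35)–(3.37) p.396; Balaban1985Variational, Prop. 6 (117)–(121) p.295, (172)–(175) p.305; Balaban1985Averaging, Prop. 2 (52)–(54) p.26] -/
theorem cur_chart_exists_tower_pi_of_small_field_unitary_uniform {d : ℕ} (hd : 1 ≤ d) (L : ℕ) [NeZero L] (m : Fin d → ℕ) [∀ i, NeZero (m i)]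
    (n : ℕ) (hL : 1 ≤ L) (hL2 : 2 ≤ L)
    {𝔸 : Type*} [NormedRing 𝔸] [NormedAlgebra ℂ 𝔸] [CompleteSpace 𝔸] [NormOneClass 𝔸] [StarRing 𝔸] [NormedStarGroup 𝔸] [StarModule ℂ 𝔸]
    [FiniteDimensional ℂ 𝔸]
    {W : Type*} [NormedAddCommGroup W] [InnerProductSpace ℂ W] [FiniteDimensional ℂ W] (φ : W ≃ₗ[ℂ] 𝔸) {Mφ Mφ' : ℝ} (hMφ : 0 ≤ Mφ)
    (hMφ' : 0 ≤ Mφ') (hφ : ∀ w, ‖φ w‖ ≤ Mφ * ‖w‖) (hφ' : ∀ X, ‖φ.symm X‖ ≤ Mφ' * ‖X‖)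
    (τ : 𝔸 →ₗ[ℂ] ℂ) {Cτ : ℝ} (hτ : ∀ X, ‖τ X‖ ≤ Cτ * ‖X‖) (hCτ : 0 ≤ Cτ)
    (hτφ : ∀ X Y : 𝔸, inner ℂ (φ.symm X) (φ.symm Y) = τ (star X * Y)) (htr : ∀ X Y : 𝔸, τ (X * Y) = τ (Y * X))
    (hτ₁ : ∀ X : 𝔸, τ (star X) = conj (τ X))
    {η : ℝ} [Fact (0 < (L : ℝ))] [Fact (0 < η)] (hηL : η * (L : ℝ) ^ (n + 1) = 1) (hL3 : 3 ≤ L ^ (n + 1))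
    {lev₀ : Bond d (towerP L m (n + 1)) → ℕ} {levB : Bond d m → ℕ} (lev₁ : Bond d (towerP L m (n + 1)) × Fin d → ℕ)
    {G : Subgroup 𝔸ˣ} (hG : AvgClosed d L G) {α₀ : ℝ} (hα₀ : 0 < α₀) (hα3 : C0 d * α₀ ≤ 1 / 3) (hα4 : 4 * α₀ ≤ c2' d L)
    (hαL : 50 * (d + 1) * αT d L α₀ * (L : ℝ) ^ d ≤ 1 / 2) (hlev : ∀ b, n + 1 ≤ lev₀ b)
    {ρ : ℝ} (hρ0 : 0 < ρ) (hρ : Real.exp (4 * (800 * ((d : ℝ) + 1) ^ 2 * ((d : ℝ) + 4)) * α₀) * (1 + 8 * (131072 * ((d : ℝ) + 1) ^ 2) * ρ) ≤ 2)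
    (hρc : 2 * ρ ≤ c3 d L) {c₀ c₁ : ℝ} [Fact (0 < c₀)] [Fact (0 < c₁)] (hw : c₀ * ((L : ℝ) ^ (n + 1)) ^ d = c₁)
    {a : ℝ} (ha : 0 < a) {a' : ℝ} (ha' : 0 < a') {C₄ a₃ : ℝ} (hC₄ : 0 ≤ C₄) (ha₃ : 0 < a₃) :
    ∃ α₁ ε₄ εC Rb R' : ℝ, 0 < α₁ ∧ 0 < Rb ∧ 0 < R' ∧ ∀ (U : Bond d (towerP L m (n + 1)) → 𝔸ˣ)
      (hUG : ∀ (x : B7Prop1Explicit.Site d) (κ : Fin d), perCfg (towerP L m (n + 1)) U x κ ∈ G) {α : ℝ}, 0 ≤ α → α ≤ α₁ →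
      (∀ b, star (U b : 𝔸) = (((U b)⁻¹ : 𝔸ˣ) : 𝔸)) → (∀ b, ‖(U b : 𝔸) - 1‖ ≤ α * η) →
      (∀ p : B9SectCLatticeCarrier.Plaq d (towerP L m (n + 1)), ‖(plaqHolU U p : 𝔸) - 1‖ ≤ α * η ^ 2) →
      ∀ {Wq : Space115 (L : ℝ) η lev₀ lev₁ (nabla115 η U) → NegSize (L : ℝ) η lev₀ 3 𝔸}, QuadAnalytic Wq C₄ a₃ →
        AnalyticOnNhd ℂ Wq {Y | ‖Y‖ < a₃} →
      ∃ h52 : pdev (perCfg (towerP L m (n + 1)) U) < α₀ * (((L : ℝ) ^ (n + 1))⁻¹) ^ 2,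
      ∃ hpos' : ∀ x : SiteL2K ℂ d (towerP L m (n + 1)) c₀ W, x ≠ 0 →
          0 < RCLike.re (inner ℂ x (laplacePrimeAk L m n φ η U a' (c₁ := c₁) x)),
      ∃ hpos : ∀ x : BondL2K ℂ d (towerP L m (n + 1)) c₀ W, x ≠ 0 →
          0 < RCLike.re (inner ℂ x (laplaceAkPi L m n φ τ η U a' hpos' hL (fun _ => αT d L α₀) (fun _ => αT_le hL hα4)
            (ulev_mem_U1_of_pdev L m (n + 1) U hL2 hG hUG hα₀ hα3 hα4 h52) (ulev_reg_of_pdev L m (n + 1) U hL2 hG hUG hα₀ hα3 hα4 h52)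
            (c₁ := c₁) a x)),
        DifferentiableOn ℂ (chartHB (frakGLatticeCLM (lev₀ := lev₀) φ hpos (QkW_surjective L m n φ U hL _ _ _ _ fun _ => hαL) lev₁ (nabla115 η U))
            0 Wq 0 (fun A' => A' + solA (H1LatticeCLM (lev₀ := lev₀) (levB := levB) φ hpos (QkW_surjective L m n φ U hL _ _ _ _ fun _ => hαL) lev₁
              (nabla115 η U)) 0 (Cck L m η (n + 1) U lev₀ lev₁ (nabla115 η U) levB) 0 εC A') ε₄
            (H1LatticeCLM (lev₀ := lev₀) (levB := levB) φ hpos (QkW_surjective L m n φ U hL _ _ _ _ fun _ => hαL) lev₁ (nabla115 η U)))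
          (ball (0 : NegSize (L : ℝ) η levB 0 𝔸) Rb) ∧
        MapsTo (chartHB (frakGLatticeCLM (lev₀ := lev₀) φ hpos (QkW_surjective L m n φ U hL _ _ _ _ fun _ => hαL) lev₁ (nabla115 η U))
            0 Wq 0 (fun A' => A' + solA (H1LatticeCLM (lev₀ := lev₀) (levB := levB) φ hpos (QkW_surjective L m n φ U hL _ _ _ _ fun _ => hαL) lev₁
              (nabla115 η U)) 0 (Cck L m η (n + 1) U lev₀ lev₁ (nabla115 η U) levB) 0 εC A') ε₄
            (H1LatticeCLM (lev₀ := lev₀) (levB := levB) φ hpos (QkW_surjective L m n φ U hL _ _ _ _ fun _ => hαL) lev₁ (nabla115 η U)))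
          (ball (0 : NegSize (L : ℝ) η levB 0 𝔸) Rb) (ball (0 : Space115 (L : ℝ) η lev₀ lev₁ (nabla115 η U)) R') ∧
        chartHB (frakGLatticeCLM (lev₀ := lev₀) φ hpos (QkW_surjective L m n φ U hL _ _ _ _ fun _ => hαL) lev₁ (nabla115 η U))
            0 Wq 0 (fun A' => A' + solA (H1LatticeCLM (lev₀ := lev₀) (levB := levB) φ hpos (QkW_surjective L m n φ U hL _ _ _ _ fun _ => hαL) lev₁
              (nabla115 η U)) 0 (Cck L m η (n + 1) U lev₀ lev₁ (nabla115 η U) levB) 0 εC A') ε₄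
            (H1LatticeCLM (lev₀ := lev₀) (levB := levB) φ hpos (QkW_surjective L m n φ U hL _ _ _ _ fun _ => hαL) lev₁ (nabla115 η U)) 0 = 0 := by
  have hc₀ : 0 < c₀ := Fact.out
  have hη0 : 0 < η := Fact.out
  have hL0 : (0 : ℝ) < L := by exact_mod_cast lt_of_lt_of_le (by norm_num) hL2
  have hr0 : (0 : ℝ) ≤ 1 / (L : ℝ) := by positivity
  have hr1 : 1 / (L : ℝ) < 1 := by rw [div_lt_one hL0]; exact_mod_cast lt_of_lt_of_le (by norm_num) hL2
  have hρw : 0 ≤ |η| ^ d / c₀ := by positivity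
  -- the three π-suppliers, `∃`-first (level-free thresholds), at `r = 1∕L`, `ρ_w := |η|^d∕c₀`
  obtain ⟨αP, C, hαP, hC, HP⟩ :=
    exists_energy_ball_pi_CLM_diagonal_closed hd L hL φ hMφ hMφ' hφ hφ' ha ha' hr0 hr1 τ hτ hCτ hρw hτ₁ htr hτφ
  obtain ⟨αQ, hαQ, HQ⟩ := exists_laplaceAkPi_pos_diagonal_closed (d := d) L hL φ hMφ hMφ' hφ hφ' ha ha' hr0 hr1 τ hτ hCτ hρw
  obtain ⟨αS, γ', hαS, hγ', HS⟩ := exists_strong_site_coercive_tower_diagonal (d := d) L φ hMφ hMφ' hφ hφ' ha' hr0 hr1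
  -- the α-linear two-window feed below the least threshold
  obtain ⟨T, hT, F⟩ := twoWindows_linear_feed L hL2 (d := d) (𝔸 := 𝔸) (lt_min hαP (lt_min hαQ hαS))
  -- the U-FREE bounds of the chart letters at print's operator ((117)'s finite-lattice factors displayed by the supplier)
  obtain ⟨CH, hCHdef⟩ : ∃ CH : ℝ, CH = C * (max (B11Eq115Space.NegSup.wSup (levWeight (L : ℝ) η lev₀ 1) : ℝ)
      (B11Eq115Space.NegSup.wSup (levWeight (L : ℝ) η lev₁ 2) * (2 * ‖((η : ℂ))⁻¹‖)) *
      (Mφ * Real.sqrt (c₁ * Fintype.card (Bond d m)) * Mφ' / Real.sqrt c₀) *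
      B11Eq115Space.NegSup.wInvSup (levWeight (L : ℝ) η levB 0)) := ⟨_, rfl⟩
  obtain ⟨CG, hCGdef⟩ : ∃ CG : ℝ, CG = C * (max (B11Eq115Space.NegSup.wSup (levWeight (L : ℝ) η lev₀ 1) : ℝ)
      (B11Eq115Space.NegSup.wSup (levWeight (L : ℝ) η lev₁ 2) * (2 * ‖((η : ℂ))⁻¹‖)) *
      (Mφ * Real.sqrt (c₀ * Fintype.card (Bond d (towerP L m (n + 1)))) * Mφ' / Real.sqrt c₀) *
      B11Eq115Space.NegSup.wInvSup (levWeight (L : ℝ) η lev₀ 3)) := ⟨_, rfl⟩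
  have hCH : 0 ≤ CH := by rw [hCHdef]; positivity
  have hCG : 0 ≤ CG := by rw [hCGdef]; positivity
  -- the scalar letters of the two regimes from the BOUNDS (`C_k(U)`'s constants `C2T d α₀`, `ρ` are U-free)
  obtain ⟨j, a'', ε₄, aC, εC, R', Rb, hj, ha'', -, -, -, hR'0, hRb0, hcap, hR'le, Hreg⟩ :=
    exists_twoRegimes_radii_of_bounds (B₀ := CG) (b := CH) (b₁ := CH) (C₄ := C₄) (a₃ := a₃) (C₂ := C2T d α₀) (c₄ := ρ) hCG hCH hCH
      hC₄ ha₃ (C2T_nonneg d α₀) hρ0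
  refine ⟨min T (α₀ / 2), ε₄, εC, Rb, R', lt_min hT (by positivity), hRb0, hR'0, ?_⟩
  intro U hUG α hα0 hα1 hUstar hUη hpl Wq hW hWa
  have hαT : α ≤ T := hα1.trans (min_le_left _ _)
  have hαh : α ≤ α₀ / 2 := hα1.trans (min_le_right _ _)
  -- `U(b) ∈ G` from `Ũ ∈ G`
  have hUS : ∀ b, U b ∈ G := fun b => by
    have h := hUG (liftSite b.1) b.2
    rwa [B9Eq315QTorus.perCfg_apply, perSite_liftSite] at h
  -- the feed: E162-type small-field letters at `β = Kα`
  obtain ⟨hβ0, hβ1, hUb, hUη', hpl', hUlev, εU, hεU, hUε, hεg⟩ := F m n hG hUS hηL hα0 hαT hUη hpl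
  have hβP : (1 + 512 * (d + 1) * (d + 4)) * α ≤ αP := hβ1.trans (min_le_left _ _)
  have hβQ : (1 + 512 * (d + 1) * (d + 4)) * α ≤ αQ := hβ1.trans ((min_le_right _ _).trans (min_le_left _ _))
  have hβS : (1 + 512 * (d + 1) * (d + 4)) * α ≤ αS := hβ1.trans ((min_le_right _ _).trans (min_le_right _ _))
  -- (52) from the PLAQUETTE window: `pdev Ũ ≤ αη² < α₀η² = α₀L^{−2(n+1)}`
  have hη : ((L : ℝ) ^ (n + 1))⁻¹ = η := inv_eq_of_mul_eq_one_left hηL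
  have h52 : pdev (perCfg (towerP L m (n + 1)) U) < α₀ * (((L : ℝ) ^ (n + 1))⁻¹) ^ 2 := by
    have hp := pdev_perCfg_le_of_plaq (U := U) hUb (by positivity) hpl
    rw [hη]
    exact lt_of_le_of_lt hp (mul_lt_mul_of_pos_right (by linarith) (by positivity))
  -- mutually adjoint transporters from unitarity + the trace letters
  have hRS := hRS_of_unitary φ τ hτφ htr U hUstar
  -- `hpos′`: the site operator `Δ′_{a′,k}(U)` is positive definite (strong site coercivity at `β`)
  have hpos' : ∀ x : SiteL2K ℂ d (towerP L m (n + 1)) c₀ W, x ≠ 0 →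
      0 < RCLike.re (inner ℂ x (laplacePrimeAk L m n φ η U a' (c₁ := c₁) x)) := fun x hx => by
    have h := HS n η hηL c₀ c₁ hw m U hRS _ hβ0 hβS hUb hUη' εU hεU hεg hUε hUlev x
    have hx' : 0 < ‖x‖ := norm_pos_iff.2 hx
    have h2 : 0 < γ' * (‖covDerivL2K ℂ c₀ ((η : ℂ))⁻¹ (adTransportW φ (fun _ : Bond d (towerP L m (n + 1)) => (1 : 𝔸ˣ))) x‖ ^ 2 +
        ‖x‖ ^ 2) := mul_pos hγ' (add_pos_of_nonneg_of_pos (sq_nonneg _) (pow_pos hx' 2))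
    linarith
  refine ⟨h52, hpos', ?_⟩
  -- `hpos`: print's `Δ̃_{a,k}(U)` is positive definite, at E162's PRODUCED data
  have hpos : ∀ x : BondL2K ℂ d (towerP L m (n + 1)) c₀ W, x ≠ 0 →
      0 < RCLike.re (inner ℂ x (laplaceAkPi L m n φ τ η U a' hpos' hL (fun _ => αT d L α₀) (fun _ => αT_le hL hα4)
        (ulev_mem_U1_of_pdev L m (n + 1) U hL2 hG hUG hα₀ hα3 hα4 h52) (ulev_reg_of_pdev L m (n + 1) U hL2 hG hUG hα₀ hα3 hα4 h52)
        (c₁ := c₁) a x)) := fun x hx =>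
    HQ n η hηL c₀ c₁ hw le_rfl m U (fun _ => αT d L α₀) (fun _ => αT_le hL hα4)
      (ulev_mem_U1_of_pdev L m (n + 1) U hL2 hG hUG hα₀ hα3 hα4 h52) (ulev_reg_of_pdev L m (n + 1) U hL2 hG hUG hα₀ hα3 hα4 h52) εU hεU hUε
      hβ0 hβQ hRS hUb hUη' hpl' hεg hUlev hpos' x hx
  refine ⟨hpos, ?_⟩
  -- the operator-norm bounds of print's chart letters at the produced data (U-free majorants `CH`, `CG`)
  obtain ⟨hHb, hGb⟩ := HP n η hηL hL3 c₀ c₁ hw le_rfl m lev₀ levB lev₁ U (fun _ => αT d L α₀) (fun _ => αT_le hL hα4)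
    (ulev_mem_U1_of_pdev L m (n + 1) U hL2 hG hUG hα₀ hα3 hα4 h52) (ulev_reg_of_pdev L m (n + 1) U hL2 hG hUG hα₀ hα3 hα4 h52) εU hεU hUε
    hβ0 hβP hUstar hUb hUη' hpl' hεg hUlev hpos' hpos (QkW_surjective L m n φ U hL _ _ _ _ fun _ => hαL)
  have hHb' := hHb.trans (le_of_eq hCHdef.symm)
  have hGb' := hGb.trans (le_of_eq hCGdef.symm)
  -- `C_k`'s numerics and the pointwise bounds
  have hCk := quadAnalytic_Cck L m η (n + 1) U lev₀ lev₁ (nabla115 η U) levB hL2 hG hUG hα₀ hα3 hα4 h52 hlev hρ hρc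
  have hCa := analyticOnNhd_Cck L m η (n + 1) U lev₀ lev₁ (nabla115 η U) levB hL2 hG hUG hα₀ hα3 hα4 h52 hlev hρ hρc
  have hHpt : ∀ B : NegSize (L : ℝ) η levB 0 𝔸,
      ‖H1LatticeCLM (lev₀ := lev₀) (levB := levB) φ hpos (QkW_surjective L m n φ U hL _ _ _ _ fun _ => hαL) lev₁ (nabla115 η U) B‖ ≤
        CH * ‖B‖ :=
    fun B => (ContinuousLinearMap.le_opNorm _ B).trans (mul_le_mul_of_nonneg_right hHb' (norm_nonneg B))
  have hGpt : ∀ f : NegSize (L : ℝ) η lev₀ 3 𝔸,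
      ‖frakGLatticeCLM (lev₀ := lev₀) φ hpos (QkW_surjective L m n φ U hL _ _ _ _ fun _ => hαL) lev₁ (nabla115 η U) f‖ ≤ CG * ‖f‖ :=
    fun f => (ContinuousLinearMap.le_opNorm _ f).trans (mul_le_mul_of_nonneg_right hGb' (norm_nonneg f))
  obtain ⟨R, RC, hRb⟩ := Hreg (frakGLatticeCLM (lev₀ := lev₀) φ hpos (QkW_surjective L m n φ U hL _ _ _ _ fun _ => hαL) lev₁ (nabla115 η U))
    Wq (H1LatticeCLM (lev₀ := lev₀) (levB := levB) φ hpos (QkW_surjective L m n φ U hL _ _ _ _ fun _ => hαL) lev₁ (nabla115 η U))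
    (Cck L m η (n + 1) U lev₀ lev₁ (nabla115 η U) levB)
    (H1LatticeCLM (lev₀ := lev₀) (levB := levB) φ hpos (QkW_surjective L m n φ U hL _ _ _ _ fun _ => hαL) lev₁ (nabla115 η U)) hGpt hW hHpt
    hCk hHpt
  exact chartHB_triple_of_twoRegimes R hWa hj.le ha'' RC hCa hcap _ hRb hR'0 hR'le

end Summit.QuantumFields.BalabanUV.T4Continuum.NE9CurChartTowerPiUniformBall

end
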